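import Literature.AnabelianGeometry.EtaleTheta.Discharge.Sec1TranslatesNonTorsionOfOrigin
import Literature.AnabelianGeometry.EtaleTheta.Discharge.Sec1Thm110ModelTateNV
import Literature.AnabelianGeometry.EtaleTheta.Discharge.Sec1CompatOfSetting
import Literature.AnabelianGeometry.EtaleTheta.SettingModelTateDoubleUnderline
import Literature.AnabelianGeometry.EtaleTheta.SettingModelTateDeckLevels
import HarnessLib

/-!
# [EtTh] §1, class-level Prop. 1.4 (i)/(iii) «(P14iii-cl)»: distinct `Z`-translates of a theta class differ by a
# NON-torsion class — the injectivity / `m = n` shapes, and the statement HYPOTHESIS-FREE at the [EtTh] model of record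

S. Mochizuki, *The étale theta function and its Frobenioid-theoretic manifestations*, Publ. RIMS **45** (2009) [EtTh]
(refereed), §1: Prop. 1.4 (i)–(iii) PRIMS PDF pp. 20–22, Prop. 1.5 (ii)–(iii) p. 23
[cite: MochizukiEtTh2009, Prop 1.5 (iii) p.23]. Layer L2 of the abc-iut cell, seat abc-iut-w6-d076 (gen 5), L2 row
«EtTh:Prop1.4(iii) residual (P14iii-cl)» (plan/GAP-LEDGER G-w4d010-2, clause (e) «`∀ m n, (τ m − τ n)` torsion
`→ m = n`»; abc-iut-L2-lead ROWS #127).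

PROOF-ONLY companion (0 definitions, 0 `Prop` facts, nothing landed is edited or restated) of abc-iut-L2-t1's
`Sec1TranslatesNonTorsion` / `Sec1TranslatesNonTorsionOfOrigin`, whose theorem
`EtaleThetaData.not_isOfFinOrder_conj_zpow_div_conj_zpow_of_origin` proves the class-level statement

  «for `γ ∈ Π^tp_X` with non-zero image in `Z`, `m ≠ n` and a theta class `x ∈ O^×_K̈ · η̈^Θ`, the class
   `γᵐ · x · (γⁿ · x)⁻¹ ∈ H¹(Π^tp_Ÿ, Δ_Θ)` is NOT torsion»

modulo EXACTLY the §1 hypothesis structure `Compat` and the FACT-LIST names F-2498 `IsEtThOrigin`, F-0591 `Prop15iii`,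
F-2503 `Prop15ii` (the printed clause «`F̈¹/F̈² = Ẑ · log(Ü)`», GAP G-L2t1-1, having been DERIVED from these by
abc-iut-L2-t7's `Sec1LogUddNotKummer`). All three fact rows carry the FACT-LIST label «universal-closure REFUTED /
schema; instance forms open or model-witnessed». This file records:

* §1 (abstract interface, same four inputs): the two shapes in which consumers quote (P14iii-cl) —
  `eq_of_isOfFinOrder_conj_zpow_div_conj_zpow_of_origin` («torsion ⇒ `m = n`», the GAP row's clause (e) verbatim up
  to the additive/multiplicative dictionary) and `conj_zpow_injective_of_origin` (the `ℤ`-indexed family of translates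
  `m ↦ γᵐ · x` is injective: the translates are pairwise DISTINCT, the set-level content of "the `l·ℤ`-torsor");
* §2 (the [EtTh] MODEL OF RECORD, stage 2 / «Tate shear», `ThetaSetting.modelχq p 1 2` with abc-iut-w5-d171's
  `inr`-section étale-theta datum `SettingModel.etaleThetaDataχqInr p`, `η̈^Θ := etaDdχq`): ALL FOUR inputs are
  theorems of the tree there — `Compat` (abc-iut-L2-d1 `modelχq_sec2Hyps` + abc-iut-L2-t8 `Sec2Hyps.compat`),
  `IsEtThOrigin` (abc-iut-L2-t5 `modelχq_isEtThOrigin`), `Prop15iii` / `Prop15ii` (abc-iut-L2-t6 / abc-iut-w5-d171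
  `prop15iii_etaleThetaDataχqInr`, `prop15ii_etaleThetaDataχqInr`) — so (P14iii-cl) is a HYPOTHESIS-FREE kernel
  theorem at that datum: `not_isOfFinOrder_conj_zpow_div_conj_zpow_modelTate` (every theta class, every `γ` of
  non-zero degree, every `m ≠ n`), the single-translate forms `…_conj_zpow_div_modelTate` / `…_conj_div_modelTate`,
  the `m = n` and injectivity shapes, and at the printed degree-one element `σ₀ = (a, 1)` (abc-iut-L2-t6
  `toZ_inl_gfpOf_a`) the concrete instance `not_isOfFinOrder_translate_etaDdχq`; headline
  `exists_model_translates_nonTorsion`: the binder set {`Compat`, `IsEtThOrigin`, `Prop15iii`, `Prop15ii`} of the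
  abstract producer is JOINTLY INHABITED at a datum with a non-empty set of theta classes and a degree-one `γ`, where
  the conclusion therefore bites.

HONEST FRAMING. §2 is a SEMI-SYNTHETIC model (the Tate-sheared χ-twisted root of abc-iut-L2-t5, not the tempered `π₁`
of a curve): joint non-vacuity / instance evidence for the typed interface only. Nothing of [EtTh] is asserted beyond
what the cited theorems prove; a FACT row is an assumption label; typed ≠ proved; no side is taken on [IUTchIII]
Cor. 3.12.
-/

noncomputable section

namespace Literature.AnabelianGeometry.EtaleTheta

open Literature.AnabelianGeometry.SemiGraphs
open scoped IsMulCommutative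

/-! ## §1. Abstract interface: the `m = n` and injectivity shapes of (P14iii-cl) -/

namespace ThetaSetting

variable {p : ℕ} [Fact p.Prime] {D : ThetaSetting p}

namespace EtaleThetaData

variable (E : D.EtaleThetaData)

/-- **(P14iii-cl), clause (e) of GAP G-w4d010-2 («`γᵐ · η̈ − γⁿ · η̈` torsion ⇒ `m = n`»)**, for every theta class
`x ∈ O^×_K̈ · η̈^Θ` and every `γ ∈ Π^tp_X` of non-zero degree, modulo `Compat`, `IsEtThOrigin` (F-2498), `Prop15iii`
(F-0591), `Prop15ii` (F-2503) — the contrapositive of abc-iut-L2-t1's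
`not_isOfFinOrder_conj_zpow_div_conj_zpow_of_origin`. [cite: MochizukiEtTh2009, Prop 1.5 (iii) p.23] -/
theorem eq_of_isOfFinOrder_conj_zpow_div_conj_zpow_of_origin (hC : D.Compat) (hO : D.IsEtThOrigin)
    (h15 : Prop15iii E hC) (h15ii : Prop15ii E.toKummerData hC) {γ : D.PiTemp} (hγ : D.toZ γ ≠ 1)
    {x : D.H1 D.GtpYdd} (hx : x ∈ E.thetaClasses) {m n : ℤ}
    (hmn : haveI := hC.GtpYdd_normal
      IsOfFinOrder (ContH1.conj D.toTheta D.DeltaTheta (γ ^ m) x *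
        (ContH1.conj D.toTheta D.DeltaTheta (γ ^ n) x)⁻¹)) : m = n :=
  Classical.by_contradiction fun h =>
    E.not_isOfFinOrder_conj_zpow_div_conj_zpow_of_origin hC hO h15 h15ii hγ h hx hmn

/-- **Single-translate form: `γᵏ · x · x⁻¹` torsion ⇒ `k = 0`** (same inputs).
[cite: MochizukiEtTh2009, Prop 1.5 (iii) p.23] -/
theorem eq_zero_of_isOfFinOrder_conj_zpow_div_of_origin (hC : D.Compat) (hO : D.IsEtThOrigin)
    (h15 : Prop15iii E hC) (h15ii : Prop15ii E.toKummerData hC) {γ : D.PiTemp} (hγ : D.toZ γ ≠ 1)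
    {x : D.H1 D.GtpYdd} (hx : x ∈ E.thetaClasses) {k : ℤ}
    (hk : haveI := hC.GtpYdd_normal
      IsOfFinOrder (ContH1.conj D.toTheta D.DeltaTheta (γ ^ k) x * x⁻¹)) : k = 0 :=
  Classical.by_contradiction fun h => E.not_isOfFinOrder_conj_zpow_div_of_origin hC hO h15 h15ii hγ h hx hk

/-- **The `ℤ`-indexed family of translates `m ↦ γᵐ · x` of a theta class is INJECTIVE** (distinct translates are
distinct classes — the set-level content of "the `Z`-translates of `η̈^Θ`", [EtTh] Prop. 1.4 (i)/(iii)), modulo the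
same four inputs. [cite: MochizukiEtTh2009, Prop 1.4 (iii) p.22] -/
theorem conj_zpow_injective_of_origin (hC : D.Compat) (hO : D.IsEtThOrigin) (h15 : Prop15iii E hC)
    (h15ii : Prop15ii E.toKummerData hC) {γ : D.PiTemp} (hγ : D.toZ γ ≠ 1) {x : D.H1 D.GtpYdd}
    (hx : x ∈ E.thetaClasses) :
    haveI := hC.GtpYdd_normal
    Function.Injective fun m : ℤ => ContH1.conj D.toTheta D.DeltaTheta (γ ^ m) x := by
  haveI := hC.GtpYdd_normal
  intro m n hmn
  refine E.eq_of_isOfFinOrder_conj_zpow_div_conj_zpow_of_origin hC hO h15 h15ii hγ hx ?_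
  have h : ContH1.conj D.toTheta D.DeltaTheta (γ ^ m) x = ContH1.conj D.toTheta D.DeltaTheta (γ ^ n) x := hmn
  rw [h, mul_inv_cancel]
  exact IsOfFinOrder.one

/-- **A non-trivial translate MOVES every theta class**: `γᵏ · x ≠ x` for `k ≠ 0` (same inputs).
[cite: MochizukiEtTh2009, Prop 1.4 (iii) p.22] -/
theorem conj_zpow_ne_self_of_origin (hC : D.Compat) (hO : D.IsEtThOrigin) (h15 : Prop15iii E hC)
    (h15ii : Prop15ii E.toKummerData hC) {γ : D.PiTemp} (hγ : D.toZ γ ≠ 1) {x : D.H1 D.GtpYdd}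
    (hx : x ∈ E.thetaClasses) {k : ℤ} (hk : k ≠ 0) :
    haveI := hC.GtpYdd_normal
    ContH1.conj D.toTheta D.DeltaTheta (γ ^ k) x ≠ x := by
  haveI := hC.GtpYdd_normal
  intro h
  have h0 := E.conj_zpow_injective_of_origin hC hO h15 h15ii hγ hx (a₁ := k) (a₂ := 0)
    (by simpa only [zpow_zero, ContH1.conj_one_apply] using h)
  exact hk h0

/-- **`σ · x ≠ x` for every `σ` of non-zero degree** (same inputs). [cite: MochizukiEtTh2009, Prop 1.4 (iii) p.22] -/
theorem conj_ne_self_of_origin (hC : D.Compat) (hO : D.IsEtThOrigin) (h15 : Prop15iii E hC)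
    (h15ii : Prop15ii E.toKummerData hC) {σ : D.PiTemp} (hσ : D.toZ σ ≠ 1) {x : D.H1 D.GtpYdd}
    (hx : x ∈ E.thetaClasses) :
    haveI := hC.GtpYdd_normal
    ContH1.conj D.toTheta D.DeltaTheta σ x ≠ x := by
  haveI := hC.GtpYdd_normal
  intro h
  refine E.not_isOfFinOrder_conj_div_of_origin hC hO h15 h15ii hσ hx ?_
  rw [h, mul_inv_cancel]
  exact IsOfFinOrder.one

end EtaleThetaData

end ThetaSetting

/-! ## §2. The [EtTh] model of record: (P14iii-cl) hypothesis-free at `etaleThetaDataχqInr p` -/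

namespace SettingModel

open _root_.Topology _root_.Function

variable (p : ℕ) [Fact p.Prime]

/-- `Compat` at the stage-2 model `modelχq p 1 2` — abc-iut-L2-d1's `modelχq_sec2Hyps` through abc-iut-L2-t8's
`Sec2Hyps.compat` (the same term as abc-iut-L6's `compat_modelχq`, recalled to keep this file's imports inside §1).
[cite: MochizukiEtTh2009, Prop 1.5 p.22] -/
theorem compat_modelTate : (ThetaSetting.modelχq p 1 2 even_two).Compat :=
  (ThetaSetting.modelχq_sec2Hyps p 1 2 even_two).compat

/-- **(P14iii-cl) AT THE MODEL OF RECORD, hypothesis-free**: at the `inr`-section étale-theta datum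
`etaleThetaDataχqInr p` of `modelχq p 1 2` (`η̈^Θ := etaDdχq`), for EVERY theta class `x`, EVERY `γ ∈ Π^tp_X` of
non-zero degree and `m ≠ n`, the class `γᵐ · x · (γⁿ · x)⁻¹` is NOT torsion — abc-iut-L2-t1's abstract
`not_isOfFinOrder_conj_zpow_div_conj_zpow_of_origin` with its four binders the tree's theorems `compat_modelTate`,
`modelχq_isEtThOrigin`, `prop15iii_etaleThetaDataχqInr`, `prop15ii_etaleThetaDataχqInr`.
[cite: MochizukiEtTh2009, Prop 1.5 (iii) p.23] -/
theorem not_isOfFinOrder_conj_zpow_div_conj_zpow_modelTate {γ : (ThetaSetting.modelχq p 1 2 even_two).PiTemp}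
    (hγ : (ThetaSetting.modelχq p 1 2 even_two).toZ γ ≠ 1) {m n : ℤ} (hmn : m ≠ n)
    {x : (ThetaSetting.modelχq p 1 2 even_two).H1 (ThetaSetting.modelχq p 1 2 even_two).GtpYdd}
    (hx : x ∈ (etaleThetaDataχqInr p).thetaClasses) :
    haveI := (compat_modelTate p).GtpYdd_normal
    ¬ IsOfFinOrder
      (ContH1.conj (ThetaSetting.modelχq p 1 2 even_two).toTheta (ThetaSetting.modelχq p 1 2 even_two).DeltaTheta
          (γ ^ m) x *
        (ContH1.conj (ThetaSetting.modelχq p 1 2 even_two).toTheta (ThetaSetting.modelχq p 1 2 even_two).DeltaTheta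
          (γ ^ n) x)⁻¹) :=
  (etaleThetaDataχqInr p).not_isOfFinOrder_conj_zpow_div_conj_zpow_of_origin (compat_modelTate p)
    (ThetaSetting.modelχq_isEtThOrigin p 1 2 even_two) (prop15iii_etaleThetaDataχqInr p (compat_modelTate p))
    (prop15ii_etaleThetaDataχqInr p (compat_modelTate p)) hγ hmn hx

/-- **Single translate at the model, hypothesis-free**: `γᵏ · x · x⁻¹` is not torsion for `k ≠ 0`.
[cite: MochizukiEtTh2009, Prop 1.5 (iii) p.23] -/
theorem not_isOfFinOrder_conj_zpow_div_modelTate {γ : (ThetaSetting.modelχq p 1 2 even_two).PiTemp}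
    (hγ : (ThetaSetting.modelχq p 1 2 even_two).toZ γ ≠ 1) {k : ℤ} (hk : k ≠ 0)
    {x : (ThetaSetting.modelχq p 1 2 even_two).H1 (ThetaSetting.modelχq p 1 2 even_two).GtpYdd}
    (hx : x ∈ (etaleThetaDataχqInr p).thetaClasses) :
    haveI := (compat_modelTate p).GtpYdd_normal
    ¬ IsOfFinOrder
      (ContH1.conj (ThetaSetting.modelχq p 1 2 even_two).toTheta (ThetaSetting.modelχq p 1 2 even_two).DeltaTheta
          (γ ^ k) x * x⁻¹) :=
  (etaleThetaDataχqInr p).not_isOfFinOrder_conj_zpow_div_of_origin (compat_modelTate p)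
    (ThetaSetting.modelχq_isEtThOrigin p 1 2 even_two) (prop15iii_etaleThetaDataχqInr p (compat_modelTate p))
    (prop15ii_etaleThetaDataχqInr p (compat_modelTate p)) hγ hk hx

/-- **`σ · x · x⁻¹` is not torsion at the model for every `σ` of non-zero degree**, hypothesis-free.
[cite: MochizukiEtTh2009, Prop 1.5 (iii) p.23] -/
theorem not_isOfFinOrder_conj_div_modelTate {σ : (ThetaSetting.modelχq p 1 2 even_two).PiTemp}
    (hσ : (ThetaSetting.modelχq p 1 2 even_two).toZ σ ≠ 1)
    {x : (ThetaSetting.modelχq p 1 2 even_two).H1 (ThetaSetting.modelχq p 1 2 even_two).GtpYdd}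
    (hx : x ∈ (etaleThetaDataχqInr p).thetaClasses) :
    haveI := (compat_modelTate p).GtpYdd_normal
    ¬ IsOfFinOrder
      (ContH1.conj (ThetaSetting.modelχq p 1 2 even_two).toTheta (ThetaSetting.modelχq p 1 2 even_two).DeltaTheta
          σ x * x⁻¹) :=
  (etaleThetaDataχqInr p).not_isOfFinOrder_conj_div_of_origin (compat_modelTate p)
    (ThetaSetting.modelχq_isEtThOrigin p 1 2 even_two) (prop15iii_etaleThetaDataχqInr p (compat_modelTate p))
    (prop15ii_etaleThetaDataχqInr p (compat_modelTate p)) hσ hx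

/-- **Clause (e) at the model, hypothesis-free**: `γᵐ · x · (γⁿ · x)⁻¹` torsion ⇒ `m = n`.
[cite: MochizukiEtTh2009, Prop 1.5 (iii) p.23] -/
theorem eq_of_isOfFinOrder_conj_zpow_div_conj_zpow_modelTate {γ : (ThetaSetting.modelχq p 1 2 even_two).PiTemp}
    (hγ : (ThetaSetting.modelχq p 1 2 even_two).toZ γ ≠ 1)
    {x : (ThetaSetting.modelχq p 1 2 even_two).H1 (ThetaSetting.modelχq p 1 2 even_two).GtpYdd}
    (hx : x ∈ (etaleThetaDataχqInr p).thetaClasses) {m n : ℤ}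
    (hmn : haveI := (compat_modelTate p).GtpYdd_normal
      IsOfFinOrder
        (ContH1.conj (ThetaSetting.modelχq p 1 2 even_two).toTheta (ThetaSetting.modelχq p 1 2 even_two).DeltaTheta
            (γ ^ m) x *
          (ContH1.conj (ThetaSetting.modelχq p 1 2 even_two).toTheta (ThetaSetting.modelχq p 1 2 even_two).DeltaTheta
            (γ ^ n) x)⁻¹)) : m = n :=
  (etaleThetaDataχqInr p).eq_of_isOfFinOrder_conj_zpow_div_conj_zpow_of_origin (compat_modelTate p)
    (ThetaSetting.modelχq_isEtThOrigin p 1 2 even_two) (prop15iii_etaleThetaDataχqInr p (compat_modelTate p))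
    (prop15ii_etaleThetaDataχqInr p (compat_modelTate p)) hγ hx hmn

/-- **The translates of every theta class form an injective `ℤ`-family at the model**, hypothesis-free.
[cite: MochizukiEtTh2009, Prop 1.4 (iii) p.22] -/
theorem conj_zpow_injective_modelTate {γ : (ThetaSetting.modelχq p 1 2 even_two).PiTemp}
    (hγ : (ThetaSetting.modelχq p 1 2 even_two).toZ γ ≠ 1)
    {x : (ThetaSetting.modelχq p 1 2 even_two).H1 (ThetaSetting.modelχq p 1 2 even_two).GtpYdd}
    (hx : x ∈ (etaleThetaDataχqInr p).thetaClasses) :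
    haveI := (compat_modelTate p).GtpYdd_normal
    Function.Injective fun m : ℤ =>
      ContH1.conj (ThetaSetting.modelχq p 1 2 even_two).toTheta (ThetaSetting.modelχq p 1 2 even_two).DeltaTheta
        (γ ^ m) x :=
  (etaleThetaDataχqInr p).conj_zpow_injective_of_origin (compat_modelTate p)
    (ThetaSetting.modelχq_isEtThOrigin p 1 2 even_two) (prop15iii_etaleThetaDataχqInr p (compat_modelTate p))
    (prop15ii_etaleThetaDataχqInr p (compat_modelTate p)) hγ hx

/-- The printed degree-one element `σ₀ = (a, 1)` of the stage-2 model has NON-zero degree (abc-iut-L2-t6's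
`toZ_inl_gfpOf_a`). [cite: MochizukiEtTh2009, Prop 1.5 (iii) p.23] -/
theorem toZ_inl_gfpOf_a_ne_one :
    (ThetaSetting.modelχq p 1 2 even_two).toZ (SemidirectProduct.inl (gfpOf (FreeGroup.of 0))) ≠ 1 := by
  rw [toZ_inl_gfpOf_a p 1 2 even_two]
  decide

/-- **The concrete instance**: at the model of record, for EVERY `k ≠ 0` the `σ₀ᵏ`-translate of the root class
`η̈^Θ = etaDdχq` differs from it by a NON-torsion class — no hypothesis whatsoever.
[cite: MochizukiEtTh2009, Prop 1.5 (iii) p.23] -/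
theorem not_isOfFinOrder_translate_etaDdχq {k : ℤ} (hk : k ≠ 0) :
    haveI := (compat_modelTate p).GtpYdd_normal
    ¬ IsOfFinOrder
      (ContH1.conj (ThetaSetting.modelχq p 1 2 even_two).toTheta (ThetaSetting.modelχq p 1 2 even_two).DeltaTheta
          ((SemidirectProduct.inl (gfpOf (FreeGroup.of 0)) : (ThetaSetting.modelχq p 1 2 even_two).PiTemp) ^ k)
          (etaleThetaDataχqInr p).etaDd *
        (etaleThetaDataχqInr p).etaDd⁻¹) :=
  not_isOfFinOrder_conj_zpow_div_modelTate p (toZ_inl_gfpOf_a_ne_one p) hk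
    ((etaleThetaDataχqInr p).etaDd_mem_thetaClasses)

/-- **`σ₀ᵐ · η̈^Θ = σ₀ⁿ · η̈^Θ ⇒ m = n` at the model of record** — the translates of the root class are pairwise
distinct, no hypothesis. [cite: MochizukiEtTh2009, Prop 1.4 (iii) p.22] -/
theorem translate_etaDdχq_injective :
    haveI := (compat_modelTate p).GtpYdd_normal
    Function.Injective fun m : ℤ =>
      ContH1.conj (ThetaSetting.modelχq p 1 2 even_two).toTheta (ThetaSetting.modelχq p 1 2 even_two).DeltaTheta
        ((SemidirectProduct.inl (gfpOf (FreeGroup.of 0)) : (ThetaSetting.modelχq p 1 2 even_two).PiTemp) ^ m)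
        (etaleThetaDataχqInr p).etaDd :=
  conj_zpow_injective_modelTate p (toZ_inl_gfpOf_a_ne_one p) ((etaleThetaDataχqInr p).etaDd_mem_thetaClasses)

/-- **HEADLINE (joint inhabitation of the producer's binders).** There is a §1 theta setting with `Compat`, an
étale-theta datum `E`, and an element `γ` of degree one such that `IsEtThOrigin` (F-2498), `Prop15iii E` (F-0591) and
`Prop15ii E` (F-2503) ALL hold — so the binder set of abc-iut-L2-t1's abstract (P14iii-cl) producer is jointly
inhabited — and at which, consequently, for every theta class `x` (a non-empty set: `η̈^Θ ∈ O^×_K̈ · η̈^Θ`) the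
translates `γᵐ · x` (`m ∈ ℤ`) are pairwise distinct modulo torsion. Witness: `modelχq p 1 2`,
`etaleThetaDataχqInr p`, `σ₀ = (a, 1)`. [cite: MochizukiEtTh2009, Prop 1.5 (iii) p.23] -/
theorem exists_model_translates_nonTorsion :
    ∃ (D : ThetaSetting p) (hC : D.Compat) (E : D.EtaleThetaData) (γ : D.PiTemp),
      D.IsEtThOrigin ∧ ThetaSetting.Prop15iii E hC ∧ ThetaSetting.Prop15ii E.toKummerData hC ∧
      D.toZ γ = Multiplicative.ofAdd 1 ∧ E.etaDd ∈ E.thetaClasses ∧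
      ∀ x ∈ E.thetaClasses, ∀ m n : ℤ, m ≠ n →
        haveI := hC.GtpYdd_normal
        ¬ IsOfFinOrder (ContH1.conj D.toTheta D.DeltaTheta (γ ^ m) x *
          (ContH1.conj D.toTheta D.DeltaTheta (γ ^ n) x)⁻¹) :=
  ⟨ThetaSetting.modelχq p 1 2 even_two, compat_modelTate p, etaleThetaDataχqInr p,
    SemidirectProduct.inl (gfpOf (FreeGroup.of 0)), ThetaSetting.modelχq_isEtThOrigin p 1 2 even_two,
    prop15iii_etaleThetaDataχqInr p (compat_modelTate p), prop15ii_etaleThetaDataχqInr p (compat_modelTate p),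
    toZ_inl_gfpOf_a p 1 2 even_two, (etaleThetaDataχqInr p).etaDd_mem_thetaClasses,
    fun _ hx _ _ hmn => not_isOfFinOrder_conj_zpow_div_conj_zpow_modelTate p (toZ_inl_gfpOf_a_ne_one p) hmn hx⟩

end SettingModel

/-! ## §3. Tightness of the degree hypothesis (appended): degree-zero translates ARE torsion -/

namespace ThetaSetting

variable {p : ℕ} [Fact p.Prime] {D : ThetaSetting p}

/-- **The hypothesis `toZ γ ≠ 1` of (P14iii-cl) is SHARP on `Π^tp_Ÿ`**: for `γ ∈ Π^tp_Ÿ` (so `toZ γ = 1`,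
`Π^tp_Ÿ ≤ Π^tp_Y = Ker(Π^tp_X ↠ Z)`) inner automorphisms act trivially on `H¹(Π^tp_Ÿ, Δ_Θ)`
(`ContH1.conj_eq_self_of_mem`), so EVERY translate `γᵏ · x` equals `x` and `γᵏ · x · x⁻¹ = 1` IS torsion — for
every class `x`, under `Compat` alone. (On `Π^tp_Y ∖ Π^tp_Ÿ` the translate of a theta class is the 2-torsion SIGN
class of (P14ii-cl), «`Θ̈(−Ü) = −Θ̈(Ü)`», abc-iut-L2-t1 `Sec1DeckSign` / abc-iut-w5-d125 `exists_sq_one_conj_etaDd_of_deck`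
— not restated here.) [cite: MochizukiEtTh2009, Prop 1.5 (iii) p.23] -/
theorem conj_zpow_eq_self_of_mem_GtpYdd (hC : D.Compat) {γ : D.PiTemp} (hγ : γ ∈ D.GtpYdd)
    (x : D.H1 D.GtpYdd) (k : ℤ) :
    haveI := hC.GtpYdd_normal
    ContH1.conj D.toTheta D.DeltaTheta (γ ^ k) x = x := by
  haveI := hC.GtpYdd_normal
  exact ContH1.conj_eq_self_of_mem _ (Subgroup.zpow_mem _ hγ k) x

/-- **Degree-zero translates are torsion** (indeed trivial): for `γ ∈ Π^tp_Ÿ` and every `k`, `γᵏ · x · x⁻¹` has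
finite order — the exact converse direction showing that the binder `toZ γ ≠ 1` of
`not_isOfFinOrder_conj_zpow_div_of_origin` cannot be dropped. [cite: MochizukiEtTh2009, Prop 1.5 (iii) p.23] -/
theorem isOfFinOrder_conj_zpow_div_of_mem_GtpYdd (hC : D.Compat) {γ : D.PiTemp} (hγ : γ ∈ D.GtpYdd)
    (x : D.H1 D.GtpYdd) (k : ℤ) :
    haveI := hC.GtpYdd_normal
    IsOfFinOrder (ContH1.conj D.toTheta D.DeltaTheta (γ ^ k) x * x⁻¹) := by
  haveI := hC.GtpYdd_normal
  rw [conj_zpow_eq_self_of_mem_GtpYdd hC hγ x k, mul_inv_cancel]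
  exact IsOfFinOrder.one

/-- `Π^tp_Ÿ`-elements have degree zero: `toZ γ = 1` for `γ ∈ Π^tp_Ÿ ≤ Π^tp_Y`. [cite: MochizukiEtTh2009, §1 p.12] -/
theorem toZ_eq_one_of_mem_GtpYdd {γ : D.PiTemp} (hγ : γ ∈ D.GtpYdd) : D.toZ γ = 1 :=
  MonoidHom.mem_ker.mp (D.GtpYdd_le_GtpY hγ)

end ThetaSetting

end Literature.AnabelianGeometry.EtaleTheta

end
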